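import Literature.IUT.HodgeTheaters.BaseHodgeTheaters
import HarnessLib

/-!
# Model Θ- and NF-bridges at the Frobenioid level ([IUTchI] Example 5.4, Remarks 5.4.1–5.4.2) — abc-iut cell,
# layer L5 (slice R4), statements-first

Mochizuki, *Inter-universal Teichmüller theory I*, §5 (kurims May-2020 manuscript), pp. 147–151: the
"Frobenioid-theoretic lifting" (p. 151) of the base-bridges of Definition 4.6, part 1 (Example 5.4); Definition 5.5
and Corollary 5.6 are in `ThetaNFHodgeTheaters.lean`. Typed over the hypothesis structure `BaseThetaDatum` of §4 and
ONE further hypothesis structure `S5Local 𝔡` standing in for the inputs this slice consumes from other seats (each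
field quotes its sentence of print):

* [IUTchI] Def. 5.2 (i) (`ℱ`-prime-strips; owner abc-iut-L5-t4) and Remark 5.2.1 (i) (the associated
  `𝒟`-prime-strip): ambient categories `FAmb v` of isomorphs of the model data `ℱ_v` with a BASE functor to
  `Amb v` — TODO-merge:abc-iut-L5-t4 Def 5.2;
* Example 5.1 (i),(iii),(vii) (`†ℱ^⊛ ⊇ †ℱ^⊚`, `†𝒟^⊚ → †𝒟^⊛`, `†ℱ^⊛_mod`, the restriction functors and
  realifications; owner abc-iut-L5-t1, files `GlobalFrobenioids*.lean`): `FAmbG`, `FAmbGlob`, `DashArrow`,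
  `RestrictionDatum` — TODO-merge:abc-iut-L5-t1 Ex 5.1;
* Example 5.4 (iv) (`†ℱ^⊚|_δ` "well-defined up to isomorphism"): `restrictAt`; the induced poly-morphism `‡𝒟 → †𝒟^⊚`
  is DEFINED intrinsically (`FPolyHomNF.under`, via Ex. 5.4 (iii));
* Def. 3.6 (Θ-Hodge theaters; owner abc-iut-L5-t2) and p. 146–147 (`†ℱ_>` "tautologically associated to"
  `†ℋ𝒯^Θ`): `ThetaHT`, `assocStrip` — TODO-merge:abc-iut-L5-t2 Def 3.6;
* Corollary 5.3 (ii) / Remark 5.3.1 (owner abc-iut-L5-t4): NOT assumed — lifts of `𝒟`-poly-morphisms are full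
  preimages under the base functor (`liftPoly`); their uniqueness is Cor. 5.3's business.

Contents: Ex. 5.4 (i) `†ℱ_J`, the diagonal arrow (`FCapsule`, `diagonalArrow`); (ii) `†ψ^Θ_j` = lift of `†φ^Θ_j`
(`liftPoly`, `psiTheta`); (iii) `δ`-valuations (`IsDeltaVal`, via `𝕍^{±un}` of Ex. 4.3 (i)) and their intrinsic
description via `†φ^NF_⋆` (`Ex54iii`); (iv) poly-morphisms
`‡ℱ → †ℱ^⊚` (`FPolyHomNF`) and of capsules; (v) is the lifting condition `NFBridge.under_isModel` of Def. 5.5 (i);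
(vi) the restriction data induced by a poly-morphism `†ℱ_⟨J⟩ → †ℱ^⊚` and its independence of the `F_l^⋇`-conjugate
(`restrictionOf`, `Ex54vi`); (vii) "pivotal distributions" (`pivotalDistribution`); Remark 5.4.1 is visible in the
types; Remark 5.4.2 (i)–(ii) (averaging vs summing arithmetic degrees over `J`) is expository and recorded by this
sentence. Record-only; [claim: Mochizuki2012, status: disputed]; nothing here takes a side.
-/

namespace Literature.IUT.HodgeTheaters

open CategoryTheory

universe u

namespace BaseThetaDatum

variable (𝔡 : BaseThetaDatum.{u})

/-- **Local hypothesis structure for slice R4** (TODO-merge stubs, see the module docstring): the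
Frobenioid-level ambient data that Example 5.4 – Corollary 5.6 consume from Def. 5.2, Ex. 5.1, Ex. 5.4 (iv) and
Def. 3.6. [claim: Mochizuki2012, status: disputed] -/
structure S5Local where
  /-- Def. 5.2 (i) (TODO-merge:abc-iut-L5-t4): the ambient category at `v` of isomorphs of the model `ℱ_v`-datum
  (a `p_v`-adic Frobenioid, resp. the archimedean triple of Def. 5.2 (i)(b)). -/
  FAmb : 𝔡.V → Type u
  /-- category structure -/
  [catFAmb : ∀ v, Category.{u} (FAmb v)]
  /-- the model `ℱ_v` (Examples 3.2 (iii), 3.3 (i), 3.4 (i); Def. 5.2 (i)). -/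
  F : ∀ v, FAmb v
  /-- every object is an isomorph of the model. -/
  nonempty_isoF : ∀ v (X Y : FAmb v), Nonempty (X ≅ Y)
  /-- Remark 5.2.1 (i): the associated `𝒟`-prime-strip constituent ("base category"), functorially. -/
  base : ∀ v, FAmb v ⥤ 𝔡.Amb v
  /-- Ex. 5.1 (iii) (TODO-merge:abc-iut-L5-t4): the ambient category of "categories equivalent to `†ℱ^⊚`". -/
  FAmbG : Type u
  /-- category structure -/
  [catFAmbG : Category.{u} FAmbG]
  /-- the model `ℱ^⊚`. -/
  FG : FAmbG
  /-- every object is an isomorph of `ℱ^⊚` -/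
  nonempty_isoFG : ∀ X Y : FAmbG, Nonempty (X ≅ Y)
  /-- Def. 5.5 (i)(b): "`‡𝒟^⊚` … the base category" of `‡ℱ^⊚`, on objects … -/
  baseG : FAmbG → 𝔡.AmbG
  /-- … and on isomorphisms, functorially. -/
  baseGIso : ∀ {Y Y' : FAmbG}, (Y ≅ Y') → (baseG Y ≅ baseG Y')
  /-- … identities … -/
  baseGIso_refl : ∀ Y, baseGIso (Iso.refl Y) = Iso.refl _
  /-- … composites. -/
  baseGIso_trans : ∀ {Y Y' Y'' : FAmbG} (b : Y ≅ Y') (b' : Y' ≅ Y''),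
    baseGIso (b ≪≫ b') = baseGIso b ≪≫ baseGIso b'
  /-- Ex. 5.1 (iii) (TODO-merge:abc-iut-L5-t4): the ambient category of "categories equivalent to `†ℱ^⊛`". -/
  FAmbGlob : Type u
  /-- category structure -/
  [catFAmbGlob : Category.{u} FAmbGlob]
  /-- the model `ℱ^⊛`. -/
  FGlob : FAmbGlob
  /-- every object is an isomorph of `ℱ^⊛` -/
  nonempty_isoFGlob : ∀ X Y : FAmbGlob, Nonempty (X ≅ Y)
  /-- Def. 5.5 (i)(c): the arrows `‡ℱ^⊚ ⇢ ‡ℱ^⊛` — "a morphism `‡𝒟^⊚ → ‡𝒟^⊛` abstractly equivalent to the natural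
  morphism `†𝒟^⊚ → †𝒟^⊛` of Example 5.1 (i), together with an isomorphism `‡ℱ^⊚ ⥲ ‡ℱ^⊛|_{‡𝒟^⊚}`". -/
  DashArrow : FAmbG → FAmbGlob → Type u
  /-- the model arrow `ℱ^⊚ ⇢ ℱ^⊛` of Example 5.1 (iii). -/
  dashModel : DashArrow FG FGlob
  /-- Ex. 5.4 (iv): "by localizing at each of the `δ`-valuations … one may construct … an `ℱ`-prime-strip `†ℱ^⊚|_δ`
  — which is well-defined up to isomorphism — from `†ℱ^⊚`". -/
  restrictAt : ∀ Y : FAmbG, 𝔡.LabCuspG (baseG Y) → ∀ v, FAmb v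
  /-- Def. 3.6 / Remark 3.6.2 (TODO-merge:abc-iut-L5-t2): Θ-Hodge theaters and their isomorphisms (a groupoid). -/
  ThetaHT : Type u
  /-- groupoid structure (isomorphisms of Θ-Hodge theaters) -/
  [grpdThetaHT : Groupoid.{u} ThetaHT]
  /-- the model Θ-Hodge theater of Def. 3.6 (built from the initial Θ-data in Examples 3.2–3.5). -/
  HT : ThetaHT
  /-- every Θ-Hodge theater is an isomorph of the model (Def. 3.6) -/
  nonempty_isoHT : ∀ X Y : ThetaHT, Nonempty (X ≅ Y)
  /-- p. 146–147: the `ℱ`-prime-strip `†ℱ_>` "tautologically associated to" a Θ-Hodge theater, on objects … -/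
  assocStrip : ThetaHT → ∀ v, FAmb v
  /-- … and on isomorphisms (componentwise). -/
  assocStripIso : ∀ {X Y : ThetaHT}, (X ≅ Y) → ∀ v, assocStrip X v ≅ assocStrip Y v
  /-- Ex. 5.4 (iii) ("the 'image' [in the evident sense] via `†φ^NF_⋆`" of a `𝒟`-prime-strip in `𝕍(†𝒟^⊚)`): the
  valuation of `†𝒟^⊚` at which a `φ^NF`-type morphism `†𝒟_v → †𝒟^⊚` lands … -/
  valOfNF : ∀ {v} {X : 𝔡.Amb v} {Y : 𝔡.AmbG}, 𝔡.HomNF v X Y → 𝔡.Val Y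
  /-- … transported by post-composition with isomorphisms … -/
  valOfNF_postNF : ∀ {v} {X : 𝔡.Amb v} {Y Y' : 𝔡.AmbG} (f : 𝔡.HomNF v X Y) (b : Y ≅ Y'),
    valOfNF (𝔡.postNF f b) = 𝔡.valIso b (valOfNF f)
  /-- … unchanged by pre-composition with isomorphisms … -/
  valOfNF_preNF : ∀ {v} {X X' : 𝔡.Amb v} {Y : 𝔡.AmbG} (a : X' ≅ X) (f : 𝔡.HomNF v X Y),
    valOfNF (𝔡.preNF a f) = valOfNF f
  /-- … and equal to `v ∈ 𝕍 ⊆ 𝕍(K)` for the natural morphism `φ^NF_{•,v}` (Ex. 4.3 (ii): `X→_v → C_v → C_K`). -/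
  valOfNF_phiNF : ∀ v, valOfNF (𝔡.phiNF v) = 𝔡.valOfV v
  /-- Ex. 5.1 (vii) / Ex. 5.4 (vi) (TODO-merge:abc-iut-L5-t1 `GlobalFrobenioid.Fmod`, restriction functors,
  realifications): the type of "collections of isomorphism classes of restriction functors
  `(†ℱ^⊚ → †ℱ^⊛ ⊇) †ℱ^⊛_mod ⥲ †ℱ^⊛_⟨J⟩ → †ℱ_{v⟨J⟩}`, `v⟨J⟩ ∈ 𝕍⟨J⟩`, together with their natural realifications"
  attached to an isomorph `‡ℱ^⊛` and an `ℱ`-prime-strip. -/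
  RestrictionDatum : FAmbGlob → (∀ v, FAmb v) → Type u
  /-- Ex. 5.4 (vi): "any poly-morphism `†ℱ_⟨J⟩ → †ℱ^⊚` induces, via restriction, an isomorphism class of functors
  … for each `v⟨J⟩ ∈ 𝕍⟨J⟩`" (given `†ℱ^⊚ ⇢ †ℱ^⊛`). -/
  restrictionOf : ∀ {Y : FAmbG} {Z : FAmbGlob}, DashArrow Y Z → ∀ X : ∀ v, FAmb v,
    𝔡.LabCuspG (baseG Y) → RestrictionDatum Z X

namespace S5Local

attribute [instance] catFAmb catFAmbG catFAmbGlob grpdThetaHT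

variable {𝔡} (S : S5Local 𝔡)

/-! ### `ℱ`-prime-strips over the stub and their associated `𝒟`-prime-strips -/

/-- Def. 5.2 (i) (TODO-merge:abc-iut-L5-t4): an `ℱ`-prime-strip `†ℱ = {†ℱ_v}_{v∈𝕍}` (object of the product category).
[claim: Mochizuki2012, status: disputed] -/
abbrev FPrimeStrip : Type u := ∀ v : 𝔡.V, S.FAmb v

variable {S}

/-- Remark 5.2.1 (i): the `𝒟`-prime-strip associated to an `ℱ`-prime-strip. [claim: Mochizuki2012, status: disputed] -/
def FPrimeStrip.base (X : S.FPrimeStrip) : 𝔡.DPrimeStrip := fun v => (S.base v).obj (X v)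

/-- Remark 5.3.1 (i)–(ii): the poly-morphism of `ℱ`-prime-strip constituents LYING OVER a poly-morphism of `𝒟`-prime-strip
constituents — the full preimage under the base functor (Cor. 5.3 (ii), not assumed, makes admissible lifts unique).
[claim: Mochizuki2012, status: disputed] -/
def liftPoly {v : 𝔡.V} (X Y : S.FAmb v) (P : PolyHom ((S.base v).obj X) ((S.base v).obj Y)) : PolyHom X Y :=
  {f | (S.base v).map f ∈ P}

/-! ### Example 5.4 (i)–(ii): capsules of `ℱ`-prime-strips, the diagonal arrow, `†ψ^Θ_⋆` -/

variable (S) in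
/-- **Example 5.4 (i)** ([IUTchI] p. 147): a capsule `†ℱ_J = ∏_{j∈J} †ℱ_j` of `ℱ`-prime-strips ("the formal product
`∏` is to be understood as denoting the capsule with index set `J`"). [claim: Mochizuki2012, status: disputed] -/
abbrev FCapsule (J : Type) : Type u := J → S.FPrimeStrip

/-- The associated capsule of `𝒟`-prime-strips `‡𝒟_J` (Def. 5.5 (i)(a)). [claim: Mochizuki2012, status: disputed] -/
def FCapsule.base {J : Type} (X : S.FCapsule J) : 𝔡.DCapsule J := fun j => (X j).base

/-- **Example 5.4 (i)**: the "diagonal arrow" `†ℱ_⟨J⟩ → †ℱ_J = ∏ †ℱ_j`: "the datum indexed by `j` is given by the full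
poly-isomorphism `†ℱ_⟨J⟩ ⥲ †ℱ_j`" (`†ℱ_⟨J⟩` "situated in a diagonal fashion"). [claim: Mochizuki2012, status: disputed] -/
def diagonalArrow {J : Type} (XJ : S.FPrimeStrip) (X : S.FCapsule J) : ∀ (j : J) (v : 𝔡.V), PolyHom (XJ v) (X j v) :=
  fun j v => PolyHom.full (XJ v) (X j v)

/-- Ex. 5.4 (i): "`†ℱ_⟨J⟩` may be related to `†ℱ_>` via the full poly-isomorphism" — nonempty. [claim: Mochizuki2012, status: disputed] -/
theorem FPrimeStrip.nonempty_iso (X Y : S.FPrimeStrip) : Nonempty (X ≅ Y) :=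
  ⟨Pi.isoMk fun v => (S.nonempty_isoF v (X v) (Y v)).some⟩

/-- **Example 5.4 (ii)** ([IUTchI] p. 147): `†ψ^Θ_j : †ℱ_j → †ℱ_>`, "the poly-morphism uniquely determined by `†φ^Θ_j`
[Remark 5.3.1]", `†ψ^Θ_⋆ = {†ψ^Θ_j}_{j∈J}` "lying over" `†φ^Θ_⋆`. [claim: Mochizuki2012, status: disputed] -/
def psiTheta {J : Type} (X : S.FCapsule J) (Y : S.FPrimeStrip) (φ : DCapsule.PolyHom X.base Y.base) :
    ∀ (j : J) (v : 𝔡.V), PolyHom (X j v) (Y v) :=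
  fun j v => liftPoly (X j v) (Y v) (φ j v)

/-! ### Example 5.4 (iii)–(v): `δ`-valuations, poly-morphisms `‡ℱ → †ℱ^⊚`, `†ψ^NF_⋆` -/

/-- **Example 5.4 (iii)** ([IUTchI] p. 147–148): for `δ ∈ LabCusp(†𝒟^⊚)`, "there exists a unique `Aut_ε(†𝒟^⊚)`-orbit of
isomorphisms `†𝒟^⊚ ⥲ 𝒟^⊚` that maps `δ ↦ [ε]`"; a `δ`-*valuation* `∈ 𝕍(†𝒟^⊚)` is "any element that maps to an element of
`𝕍^{±un}` via this `Aut_ε(†𝒟^⊚)`-orbit of isomorphisms". [claim: Mochizuki2012, status: disputed] -/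
def IsDeltaVal (Y : 𝔡.AmbG) (δ : 𝔡.LabCuspG Y) (w : 𝔡.Val Y) : Prop :=
  ∃ b : Y ≅ 𝔡.DG, 𝔡.labIsoG b δ = 𝔡.εLab ∧ 𝔡.valIso b w ∈ 𝔡.VPlusMinusUn

/-- Ex. 5.4 (iii): isomorphisms `†𝒟^⊚ ⥲ 𝒟^⊚` mapping `δ ↦ [ε]` exist (and form one `Aut_ε`-orbit). [claim: Mochizuki2012, status: disputed] -/
theorem exists_iso_labIsoG_eq_εLab (Y : 𝔡.AmbG) (δ : 𝔡.LabCuspG Y) :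
    ∃ b : Y ≅ 𝔡.DG, 𝔡.labIsoG b δ = 𝔡.εLab := by
  obtain ⟨a⟩ := 𝔡.nonempty_isoG Y 𝔡.DG
  obtain ⟨j, hj, -⟩ := (𝔡.isTorsor_labCuspG 𝔡.DG).existsUnique_smul_eq (𝔡.labIsoG a δ) 𝔡.εLab
  obtain ⟨b₀, hb₀⟩ := 𝔡.exists_aut_smul j
  exact ⟨a ≪≫ b₀, by rw [𝔡.labIsoG_trans, Equiv.trans_apply, hb₀, hj]⟩

variable (S) in
/-- **Example 5.4 (iii)**, intrinsic form ([IUTchI] p. 148): "[one verifies immediately that] a `δ`-valuation may be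
defined as a valuation `∈ 𝕍(†𝒟^⊚)` that lies in the "image" via `†φ^NF_⋆` of the unique `𝒟`-prime-strip `†𝒟_j` of the
capsule `†𝒟_J` such that the bijection `LabCusp(†𝒟^⊚) ⥲ LabCusp(†𝒟_j)` induced by `†φ^NF_⋆` maps `δ` to the element of
`LabCusp(†𝒟_j)` that is labeled `1`" — as a MODEL-RELATIVE statement about the stub (it uses `valOfNF`).
[claim: Mochizuki2012, status: disputed] -/
def Ex54iii : Prop :=
  ∀ (B : 𝔡.DNFBridge) (δ : 𝔡.LabCuspG B.glob) (w : 𝔡.Val B.glob),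
    IsDeltaVal B.glob δ w ↔
      ∃ j : B.J, (∀ (v : 𝔡.V) (f : 𝔡.HomNF v (B.capsule j v) B.glob), f ∈ B.poly j v →
          (𝔡.isTorsor_labCusp v (B.capsule j v)).labelEquiv (𝔡.η v (B.capsule j v)) (𝔡.labPull f δ) = 1) ∧
        ∃ (v : 𝔡.V) (f : 𝔡.HomNF v (B.capsule j v) B.glob), f ∈ B.poly j v ∧ S.valOfNF f = w

variable (S) in
/-- **Example 5.4 (iv)** ([IUTchI] p. 148): a poly-morphism `‡ℱ → †ℱ^⊚` is "a full poly-isomorphism `‡ℱ ⥲ †ℱ^⊚|_δ` for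
some `δ ∈ LabCusp(†𝒟^⊚)`" — the full poly-isomorphism carrying no datum, it IS the choice of `δ`. [claim: Mochizuki2012, status: disputed] -/
def FPolyHomNF (_X : S.FPrimeStrip) (Y : S.FAmbG) : Type := 𝔡.LabCuspG (S.baseG Y)

/-- Ex. 5.4 (iv): the full poly-isomorphism `‡ℱ ⥲ †ℱ^⊚|_δ` underlying a poly-morphism `‡ℱ → †ℱ^⊚` (nonempty).
[claim: Mochizuki2012, status: disputed] -/
def FPolyHomNF.polyIso {X : S.FPrimeStrip} {Y : S.FAmbG} (δ : FPolyHomNF S X Y) : PolyIso X (S.restrictAt Y δ) :=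
  PolyIso.full _ _

/-- Ex. 5.4 (iii)–(iv) ([IUTchI] p. 148): "such a poly-morphism `‡ℱ → †ℱ^⊚` may be thought of as lying over an induced
poly-morphism `‡𝒟 → †𝒟^⊚`" — pinned down INTRINSICALLY by (iii): the `φ^NF`-type morphisms `‡𝒟_v → †𝒟^⊚` along which
the class `δ` pulls back to "the element of `LabCusp(‡𝒟_v)` that is labeled `1`", i.e. to the canonical element
(formulation due to abc-iut-L5-t8's audit, 2026-08-25). [claim: Mochizuki2012, status: disputed] -/
def FPolyHomNF.under {X : S.FPrimeStrip} {Y : S.FAmbG} (δ : FPolyHomNF S X Y) : X.base.PolyHomNF (S.baseG Y) :=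
  fun v => {f | 𝔡.labPull f δ = 𝔡.η v (X.base v)}

/-- **Example 5.4 (iv)**, capsules: "a poly-morphism `{ᵉℱ}_{e∈E} → †ℱ^⊚` [is] a collection of poly-morphisms
`{ᵉℱ → †ℱ^⊚}_{e∈E}`". [claim: Mochizuki2012, status: disputed] -/
def FCapsule.PolyHomNF {E : Type} (X : S.FCapsule E) (Y : S.FAmbG) : Type := ∀ e, FPolyHomNF S (X e) Y

/-- **Example 5.4 (iv)**, capsules: "(respectively, `{ᵉℱ}_{e∈E} → †ℱ`) … a collection of poly-morphisms
`{ᵉℱ → †ℱ}_{e∈E}`". [claim: Mochizuki2012, status: disputed] -/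
abbrev FCapsule.PolyHom {E : Type} (X : S.FCapsule E) (Y : S.FPrimeStrip) : Type u :=
  ∀ (e : E) (v : 𝔡.V), Literature.IUT.HodgeTheaters.PolyHom (X e v) (Y v)

/-! ### Example 5.4 (vi)–(vii): restriction data and pivotal distributions -/

variable (S) in
/-- **Example 5.4 (vi)** ([IUTchI] p. 149–150), the claim: the restriction functors induced by a poly-morphism
`†ℱ_⟨J⟩ → †ℱ^⊚` are "independent of the choice of the poly-morphism `†ℱ_⟨J⟩ → †ℱ^⊚` [i.e., among its
`F_l^⋇`-conjugates]" — "`†ℱ^⊛_mod` is defined in terms of terminal objects of `†𝒟^⊛` … immune to [i.e., fixed by] the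
various indeterminacies". As a MODEL-RELATIVE statement about the stub `S`. [claim: Mochizuki2012, status: disputed] -/
def Ex54vi : Prop :=
  ∀ (Y : S.FAmbG) (Z : S.FAmbGlob) (d : S.DashArrow Y Z) (X : S.FPrimeStrip) (δ δ' : FPolyHomNF S X Y),
    S.restrictionOf d X δ = S.restrictionOf d X δ'

/-- **Example 5.4 (vii)** ([IUTchI] p. 150): the "pivotal distributions" `†ℱ^⊛_pvt → †ℱ_pvt`, `†ℱ^{⊛ℝ}_pvt → †ℱ^ℝ_pvt`
— "the objects constructed in (vi) in the case `j = 1`" (Fig. 5.2): the restriction datum attached to the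
constituent of label `1` of a capsule equipped with poly-morphisms to `†ℱ^⊚ ⇢ †ℱ^⊛` and with labels `χ`.
[claim: Mochizuki2012, status: disputed] -/
def pivotalDistribution {J : Type} {Y : S.FAmbG} {Z : S.FAmbGlob} (d : S.DashArrow Y Z) (X : S.FCapsule J)
    (ψ : FCapsule.PolyHomNF X Y) (χ : J ≃ FlStar 𝔡.l) : S.RestrictionDatum Z (X (χ.symm 1)) :=
  S.restrictionOf d (X (χ.symm 1)) (ψ (χ.symm 1))

end S5Local

end BaseThetaDatum

end Literature.IUT.HodgeTheaters
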